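import Literature.NumberTheory.Rogawski1990.ArchStableOrbitalWallStepOrbitMeasure  -- ★ p841391 (R1-e′): the three readings of the state at `w`; brings ★ (R1-a), ★ (δ8), ★ (R3-f)
import Literature.NumberTheory.Automorphic.ArchLocalTorusOrbitalCompactWallContinuity  -- ★ `continuousOn_integral_comp_conj_circleDiagonal_of_blocks` (continuity through compact walls)
import HarnessLib

/-!
# THE COMPACT STEP of the place-by-place descent: at a COMPACT wall of a place `w` (every wall of a DEFINITE place; the same-sign walls of an indefinite one) the
# orbit-measure state is CONTINUOUS in the moving coordinate ((R1-g) of R1 «(L-use) at all indefinite places»; Rogawski 1990 §8.2 p. 122–123, Shelstad 1979 §4)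

Topic `NumberTheory/Rogawski1990`; namespace `Literature.NumberTheory.Rogawski1990`.  THEOREMS ONLY (no `def`, no instance, no notation, no axiom, no `sorry`).
Cell `pub/hodgecm-mathlib`, ENGINE T1 (crux H413 = `stmt-HodgeConjecture-24833`); floor-2 road «(J-nc) in-house», brick (R1-g) of R1 `stub_LuseAllPlaces` (LEAD F0P3a-plan (g9) WORDS
T8-53 ∕ T8-57 ∕ T8-61; census `CENSUS-R1-LuseAllPlaces` 8d436054; author F0P3a-p07 (g7), 2026-09-01).

WHY.  The split-singular rational point `γ₀ ⊗ 1` is singular at EVERY complex place: at the indefinite places the moving coordinate jumps (★ (R1-e′) p841391, the derivative of `2 sin ψ · Σ_ρ I`),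
but at the DEFINITE places (and for the same-sign relabellings of an indefinite place) the centraliser is compact and the state is simply CONTINUOUS across the wall — the (L-use)
induction takes a plain limit there.  THIS FILE: for a relabelling `ρ` whose `w`-wall is compact (`0 < re σ_w(α_{ρ⁻¹0})·re σ_w(α_{ρ⁻¹2})`),
`ψ ↦ I(μ[w ↦ ν.map (y ↦ y·diag(γ_{z₀}(ψ)∘ρ)·y⁻¹)])` tends, as `ψ → 0`, to `I(μ[w ↦ ν.map (y ↦ y·diag(z₀∘ρ)·y⁻¹)])` (★ (R1-a) test function + ★ `continuousOn_integral_comp_conj_circleDiagonal_of_blocks`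
with the block labelling `i ↦ (ρ i = 1)` of ★ p840971 §3 + ★ (R1-e′) §2 readings on a punctured neighbourhood where the curve is regular).
HONEST LABEL: HC_CM is proved only modulo the 7 printed citations until rung 0 closes; this file is continuity bookkeeping and pays nothing by itself.

## References
* [Rogawski1990] J. D. Rogawski, *Automorphic Representations of Unitary Groups in Three Variables*, Ann. of Math. Stud. 123 (1990), §8.2 p. 122–123 (continuity of `F_f` through the
  compact walls), §14.5 p. 238.
* [Shelstad1979] D. Shelstad, *Characters and inner forms of a quasi-split group over ℝ*, Compositio Math. 39 (1979), §4.
* [BorelJacquet1979] A. Borel, H. Jacquet, *Automorphic forms and automorphic representations*, PSPM 33.1 (1979), §4.1.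
-/

set_option autoImplicit false

noncomputable section

open MeasureTheory Measure Filter Topology NumberField NumberField.InfinitePlace NumberField.mixedEmbedding Equiv Function Set
open Literature.MeasureTheory.Group Literature.NumberTheory.Automorphic Literature.NumberTheory.Automorphic.UnitaryGroup
open Literature.LinearAlgebra.Matrix
open scoped Matrix MatrixGroups Matrix.Norms.Operator ContDiff

namespace Literature.NumberTheory.Rogawski1990

variable (L : Type) [Field L] (α : Fin 3 → L) (w : {w : InfinitePlace L // IsComplex w})

/-! ## §1 The block labelling of a relabelled split wall -/

/-- Two distinct indices off the distinguished slot `1` are `{0, 2}`. [cite: Rogawski1990, §8.2 p. 122] -/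
private theorem fin3_pair_eq_of_ne_one' (k l : Fin 3) (hkl : k ≠ l) (hk : k ≠ 1) (hl : l ≠ 1) : (k = 0 ∧ l = 2) ∨ (k = 2 ∧ l = 0) := by
  revert k l
  decide

/-- Indices separated by the labelling `(· = 1)`. [cite: Rogawski1990, §8.2 p. 122] -/
private theorem fin3_sep_of_decide_ne' (k l : Fin 3) (h : decide (k = 1) ≠ decide (l = 1)) :
    (k = 1 ∧ (l = 0 ∨ l = 2)) ∨ (l = 1 ∧ (k = 0 ∨ k = 2)) := by
  revert k l
  decide

/-- **The block labelling `i ↦ (ρ i = 1)` has constant sign on blocks at a compact `ρ`-wall.** [cite: Rogawski1990, §8.2 p. 122] -/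
theorem sign_pos_of_blockLabel_perm_eq (ρ : Perm (Fin 3)) (hpos : 0 < (w.1.embedding (α (ρ⁻¹ 0))).re * (w.1.embedding (α (ρ⁻¹ 2))).re) :
    ∀ i j : Fin 3, i ≠ j → decide (ρ i = 1) = decide (ρ j = 1) → 0 < (w.1.embedding (α i)).re * (w.1.embedding (α j)).re := by
  have hinv : ∀ {i : Fin 3} {k : Fin 3}, ρ i = k → ρ⁻¹ k = i := fun {i} {k} h => by
    rw [← h]; exact ρ.symm_apply_apply i
  intro i j hij hb
  have hi1 : ρ i ≠ 1 := fun h1 => by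
    have hj1 : ρ j = 1 := by simpa [h1] using hb.symm
    exact hij (ρ.injective (h1.trans hj1.symm))
  have hj1 : ρ j ≠ 1 := fun h1 => by
    have hi1' : ρ i = 1 := by simpa [h1] using hb
    exact hi1 hi1'
  rcases fin3_pair_eq_of_ne_one' (ρ i) (ρ j) (fun h => hij (ρ.injective h)) hi1 hj1 with ⟨hi, hj⟩ | ⟨hi, hj⟩
  · rw [← hinv hi, ← hinv hj]; exact hpos
  · rw [← hinv hi, ← hinv hj, mul_comm]; exact hpos

/-- **The relabelled wall point `z₀ ∘ ρ` is block-separated** for the labelling `i ↦ (ρ i = 1)` (`z₀ 0 = z₀ 2 ≠ z₀ 1`). [cite: Rogawski1990, §8.2 p. 122] -/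
theorem blockSeparated_comp_perm_of_wall {z₀ : Fin 3 → Circle} (h02 : z₀ 0 = z₀ 2) (h01 : z₀ 0 ≠ z₀ 1) (ρ : Perm (Fin 3)) :
    ∀ i j : Fin 3, decide (ρ i = 1) ≠ decide (ρ j = 1) → (z₀ ∘ ⇑ρ) i ≠ (z₀ ∘ ⇑ρ) j := by
  intro i j hb
  simp only [Function.comp_apply]
  rcases fin3_sep_of_decide_ne' (ρ i) (ρ j) hb with ⟨hi, hj | hj⟩ | ⟨hj, hi | hi⟩
  · rw [hi, hj]; exact fun h => h01 h.symm
  · rw [hi, hj, ← h02]; exact fun h => h01 h.symm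
  · rw [hi, hj]; exact h01
  · rw [hi, hj, ← h02]; exact h01

variable [NumberField L] [IsCMField L] [MeasurableSpace (GL (Fin 3) ℂ)] [BorelSpace (GL (Fin 3) ℂ)]
  [MeasurableSpace (arch (↥(maximalRealSubfield L)) L (IsCMField.complexConj L) 3 (Matrix.diagonal α))] [BorelSpace (arch (↥(maximalRealSubfield L)) L (IsCMField.complexConj L) 3 (Matrix.diagonal α))]

/-! ## §2 The compact step -/

open scoped Classical in
/-- **(R1-g) THE COMPACT STEP**: at a compact `w`-wall of the relabelling `ρ` the orbit-measure state along the moving curve is continuous at the wall: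
`I(μ[w ↦ ν.map (y ↦ y·diag(γ_{z₀}(ψ)∘ρ)·y⁻¹)]) ⟶ I(μ[w ↦ ν.map (y ↦ y·diag(z₀∘ρ)·y⁻¹)])` as `ψ → 0`, for every global test function `Θ` and every family `μ` of Radon measures at the
other places (★ (R1-a) + ★ continuity through compact walls + ★ (R1-e′) §2 readings; the curve is regular on a punctured neighbourhood ★ `eventually_injective_splitCurve`).
[cite: Rogawski1990, §8.2 p. 122–123] [cite: Shelstad1979, §4] [cite: BorelJacquet1979, §4.1] -/
theorem tendsto_integral_pi_update_map_conj_splitCurve_compactWall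
    (hα : ∀ i, α i ≠ 0) (hherm : ∀ i, (IsCMField.complexConj L (α i) : L) = α i)
    (ν : Measure (archLocal L 3 (Matrix.diagonal α) w)) [IsFiniteMeasureOnCompacts ν]
    (Θ : Matrix (Fin 3) (Fin 3) (mixedSpace L) → ℂ) (hΘ : ContDiff ℝ (⊤ : ℕ∞) Θ)
    (hΘc : HasCompactSupport fun g : arch (↥(maximalRealSubfield L)) L (IsCMField.complexConj L) 3 (Matrix.diagonal α) => Θ ((g : GL (Fin 3) (mixedSpace L)) : Matrix (Fin 3) (Fin 3) (mixedSpace L)))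
    (μall : ∀ v : {w : InfinitePlace L // IsComplex w}, Measure (archLocal L 3 (Matrix.diagonal α) v)) [∀ v, IsFiniteMeasureOnCompacts (μall v)] [∀ v, SigmaFinite (μall v)]
    {z₀ : Fin 3 → Circle} (h02' : z₀ 0 = z₀ 2) (h01' : z₀ 0 ≠ z₀ 1) (ρ : Perm (Fin 3))
    (hpos : 0 < (w.1.embedding (α (ρ⁻¹ 0))).re * (w.1.embedding (α (ρ⁻¹ 2))).re) :
    Tendsto (fun ψ : ℝ => ∫ o, Θ ((((archPiEquivCM 3 L (Matrix.diagonal α)).symm o : arch (↥(maximalRealSubfield L)) L (IsCMField.complexConj L) 3 (Matrix.diagonal α)) : GL (Fin 3) (mixedSpace L)) : Matrix (Fin 3) (Fin 3) (mixedSpace L))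
              ∂(Measure.pi (Function.update μall w (ν.map fun y : archLocal L 3 (Matrix.diagonal α) w => y * (⟨circleDiagonal 3 ((fun i => z₀ i * Circle.exp (![(1 : ℝ), 0, -1] i * ψ)) ∘ ⇑ρ), circleDiagonal_mem_archLocal_diagonal L 3 α w ((fun i => z₀ i * Circle.exp (![(1 : ℝ), 0, -1] i * ψ)) ∘ ⇑ρ)⟩ : archLocal L 3 (Matrix.diagonal α) w) * y⁻¹))))
      (𝓝 0) (𝓝 (∫ o, Θ ((((archPiEquivCM 3 L (Matrix.diagonal α)).symm o : arch (↥(maximalRealSubfield L)) L (IsCMField.complexConj L) 3 (Matrix.diagonal α)) : GL (Fin 3) (mixedSpace L)) : Matrix (Fin 3) (Fin 3) (mixedSpace L))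
              ∂(Measure.pi (Function.update μall w (ν.map fun y : archLocal L 3 (Matrix.diagonal α) w => y * (⟨circleDiagonal 3 (z₀ ∘ ⇑ρ), circleDiagonal_mem_archLocal_diagonal L 3 α w (z₀ ∘ ⇑ρ)⟩ : archLocal L 3 (Matrix.diagonal α) w) * y⁻¹))))) := by
  haveI : ∀ v : {w : InfinitePlace L // IsComplex w}, LocallyCompactSpace (archLocal L 3 (Matrix.diagonal α) v) :=
    fun v => locallyCompactSpace_archLocal L 3 (Matrix.diagonal α) v
  haveI : ∀ v : {w : InfinitePlace L // IsComplex w}, SecondCountableTopology (archLocal L 3 (Matrix.diagonal α) v) :=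
    fun v => secondCountableTopology_archLocal L 3 (Matrix.diagonal α) v
  have hreal : ∀ i, (w.1.embedding (α i)).im = 0 := fun i => im_embedding_eq_zero_of_complexConj_eq L w (hherm i)
  -- the mixed partial integral is the restriction of a per-place test function `Θ'` (★ (R1-a))
  obtain ⟨Θ', hΘ'd, hΘ'c, hΘ'eq⟩ := exists_contDiff_eq_integral_insert L 3 α hα w (fun w' : {v : {w : InfinitePlace L // IsComplex w} // ¬ v = w} => μall w'.1) Θ hΘ hΘc
  have hcont : Continuous fun x : archLocal L 3 (Matrix.diagonal α) w => Θ' ((x : GL (Fin 3) ℂ) : Matrix (Fin 3) (Fin 3) ℂ) :=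
    hΘ'd.continuous.comp (Units.continuous_val.comp continuous_subtype_val)
  -- the torus orbital function of `Θ' ∘ coe` is continuous at the block-separated point `z₀ ∘ ρ` (compact wall ⇒ constant-sign blocks)
  have hsign := sign_pos_of_blockLabel_perm_eq L α w ρ hpos
  have hsep := blockSeparated_comp_perm_of_wall h02' h01' ρ
  have hca : ContinuousAt (fun z : Fin 3 → Circle => ∫ g : archLocal L 3 (Matrix.diagonal α) w,
      Θ' ((((g * ⟨circleDiagonal 3 z, circleDiagonal_mem_archLocal_diagonal L 3 α w z⟩ * g⁻¹ : archLocal L 3 (Matrix.diagonal α) w) : GL (Fin 3) ℂ) :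
        Matrix (Fin 3) (Fin 3) ℂ)) ∂ν) (z₀ ∘ ⇑ρ) :=
    (continuousOn_integral_comp_conj_circleDiagonal_of_blocks L 3 α w hα hreal (fun i => decide (ρ i = 1)) hsign ν _ hcont hΘ'c).continuousAt
      ((isOpen_setOf_blockSeparated fun i => decide (ρ i = 1)).mem_nhds hsep)
  -- composed with the (continuous) curve `ψ ↦ γ(ψ) ∘ ρ`, `γ(0) ∘ ρ = z₀ ∘ ρ`
  have hcurve : Continuous fun ψ : ℝ => (fun i => z₀ i * Circle.exp (![(1 : ℝ), 0, -1] i * ψ)) ∘ ⇑ρ :=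
    continuous_pi fun i => continuous_const.mul (Circle.exp.continuous.comp (continuous_const.mul continuous_id))
  have hcurve0 : ((fun i => z₀ i * Circle.exp (![(1 : ℝ), 0, -1] i * (0 : ℝ))) ∘ ⇑ρ) = z₀ ∘ ⇑ρ := by
    funext i; simp only [Function.comp_apply, mul_zero, Circle.exp_zero, mul_one]
  have hlim := (hca.tendsto.comp (by simpa only [hcurve0] using hcurve.tendsto 0))
  -- both sides are the `Θ'`-conjugation integrals, eventually (regular curve points) resp. at the compact wall (proper orbit maps)
  have hev : ∀ᶠ ψ in 𝓝 (0 : ℝ), ∫ o, Θ ((((archPiEquivCM 3 L (Matrix.diagonal α)).symm o : arch (↥(maximalRealSubfield L)) L (IsCMField.complexConj L) 3 (Matrix.diagonal α)) : GL (Fin 3) (mixedSpace L)) : Matrix (Fin 3) (Fin 3) (mixedSpace L))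
              ∂(Measure.pi (Function.update μall w (ν.map fun y : archLocal L 3 (Matrix.diagonal α) w => y * (⟨circleDiagonal 3 ((fun i => z₀ i * Circle.exp (![(1 : ℝ), 0, -1] i * ψ)) ∘ ⇑ρ), circleDiagonal_mem_archLocal_diagonal L 3 α w ((fun i => z₀ i * Circle.exp (![(1 : ℝ), 0, -1] i * ψ)) ∘ ⇑ρ)⟩ : archLocal L 3 (Matrix.diagonal α) w) * y⁻¹))) =
      ∫ g : archLocal L 3 (Matrix.diagonal α) w,
        Θ' ((((g * ⟨circleDiagonal 3 ((fun i => z₀ i * Circle.exp (![(1 : ℝ), 0, -1] i * ψ)) ∘ ⇑ρ), circleDiagonal_mem_archLocal_diagonal L 3 α w _⟩ * g⁻¹ :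
          archLocal L 3 (Matrix.diagonal α) w) : GL (Fin 3) ℂ) : Matrix (Fin 3) (Fin 3) ℂ)) ∂ν := by
    -- on the punctured neighbourhood the curve is regular; at `ψ = 0` it is the compact wall point: proper in both cases
    have hpunct : ∀ᶠ ψ in 𝓝[≠] (0 : ℝ), Function.Injective ((fun i => z₀ i * Circle.exp (![(1 : ℝ), 0, -1] i * ψ)) ∘ ⇑ρ) :=
      (eventually_injective_splitCurve z₀ h02' h01').mono fun ψ hψ => hψ.comp ρ.injective
    have hall : ∀ᶠ ψ in 𝓝 (0 : ℝ), ∀ C : Set (archLocal L 3 (Matrix.diagonal α) w), IsCompact C →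
        IsCompact {g : archLocal L 3 (Matrix.diagonal α) w | g * (⟨circleDiagonal 3 ((fun i => z₀ i * Circle.exp (![(1 : ℝ), 0, -1] i * ψ)) ∘ ⇑ρ),
          circleDiagonal_mem_archLocal_diagonal L 3 α w ((fun i => z₀ i * Circle.exp (![(1 : ℝ), 0, -1] i * ψ)) ∘ ⇑ρ)⟩ : archLocal L 3 (Matrix.diagonal α) w) * g⁻¹ ∈ C} := by
      rw [← nhdsNE_sup_pure, Filter.eventually_sup, Filter.eventually_pure]
      refine ⟨hpunct.mono fun ψ hψ C hC => isCompact_setOf_conj_circleDiagonal_mem_of_injective L 3 α w hα _ hψ C hC, fun C hC => ?_⟩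
      rw [hcurve0]
      exact isCompact_setOf_conj_circleDiagonal_comp_perm_mem_of_compactWall L α w hα hreal z₀ h02' h01' ρ hpos C hC
    filter_upwards [hall] with ψ hψ
    exact integral_pi_update_map_conj_eq_integral L α w μall ν _ hψ Θ hΘ.continuous hΘc Θ' hΘ'd.continuous hΘ'eq
  rw [integral_pi_update_map_conj_eq_integral L α w μall ν _ (fun C hC =>
    isCompact_setOf_conj_circleDiagonal_comp_perm_mem_of_compactWall L α w hα hreal z₀ h02' h01' ρ hpos C hC) Θ hΘ.continuous hΘc Θ' hΘ'd.continuous hΘ'eq]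
  exact (hlim.congr' (hev.mono fun ψ h => h.symm) : _)

end Literature.NumberTheory.Rogawski1990

end
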